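import Literature.RingTheory.HilbertSamuel.Multiplicity
import Literature.AlgebraicGeometry.Resolution.RegularLocalOrderValuation
import Summits.ResolutionOfSingularities.ResolutionOfSingularities.Theorems.HilbertSamuelEliminationSigmaMaxModificationsCorridor3HypersurfaceHilbertFunction
import Mathlib.Algebra.Group.ForwardDiff
import Mathlib.Data.Nat.Choose.Sum
import Mathlib.RingTheory.KrullDimension.Regular
import HarnessLib

/-!
# Mizutani's conjecture — the multiplicity of a hypersurface in a regular local ring is the order of its equation

Cell topic `Summits/ResolutionOfSingularities/KangarooAtlas` (pub-rosobs); namespace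
`Summit.ResolutionOfSingularities.KangarooAtlas.Mizutani`.  Companion to the Lean transcription of the in-house
note MIZUTANI-PROOF-g59 (AI-written, AI-audited; *AI review is weaker than expert review*; not a resolution
theorem).

Mizutani (Nagoya Math. J. 52 (1973) p. 85) defines `U_m(p) = {f ∈ S_m : mult_p(Proj(S/fS)) ≥ m}` with the
MULTIPLICITY of the hypersurface `Proj(S/fS) ⊂ ℙⁿ` at the point `p`, i.e. the multiplicity `e(𝒪_{ℙⁿ,p}/(f))`
(Matsumura §14) of the local ring of the hypersurface at `p`; Hironaka ([H4] p. 154) writes the ORDER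
`ν_{x'}(φ/X_0^d)` of a local equation in the regular local ring `𝒪_{ℙⁿ,x'}`.  The two agree because of the
standard fact proved in this file:

* **`samuelMultiplicity_quotient_span_singleton`** — for a REGULAR local ring `A` and `0 ≠ g ∈ 𝔪_A`:
  `e(A/gA) = ord_A(g)` (`(samuelMultiplicity (A ⧸ (g)) : ℕ∞) = adicOrder g`), with the tree's `adicOrder`
  (`RegularLocalOrderValuation.lean`) and `samuelMultiplicity` (`Literature/RingTheory/HilbertSamuel/Multiplicity.lean`,
  Matsumura §14 Formula 14.1 as the eventual value of `Δ^{dim} χ`).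

Proof: if `ord g = m` (`g ∈ 𝔪^m ∖ 𝔪^{m+1}`, `m ≥ 1`) and `dim A = d' + 1`, the res-hironaka cell's
`hilbertFun_quotient_span_singleton` (Theorems/…Corridor3HypersurfaceHilbertFunction.lean, from `gr_𝔪 A = k[X]` and
`In((g)) = (in g)`) gives the Hilbert function `H^{(0)}_{A/(g)}(n) = binom(n+d', d') − [m ≤ n] binom(n−m+d', d')`
(`hypersurfaceHFe (d'+1) m`); summing (hockey stick, `Nat.sum_range_add_choose`) the Samuel function is
`χ(n) = ℓ((A/(g))/𝔪̄^{n+1}) = binom(n+d'+1, d'+1) − [m ≤ n] binom(n−m+d'+1, d'+1)` (`sum_range_hypersurfaceHFe_cast`);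
`dim A/(g) = d'` (Mathlib `ringKrullDim_quotient_span_singleton_succ_eq_ringKrullDim_of_mem_nonZeroDivisors`, `A` is a
domain); and the `d'`-th forward difference of `χ` is the constant `m` from `n = m` on
(`fwdDiff_iter_sum_hypersurfaceHFe`: `Δ^{d'} binom(x + c, d'+1) = x + c`, Mathlib `fwdDiff_iter_choose`).

The application to `𝒪_{ℙⁿ,𝔭}` (regular by `MizutaniProjectiveRegular.lean`) — «`mult_𝔭(Proj(S/φS)) ≥ m ⟺ φ ∈
symbPow k 𝔭 m`», Mizutani's `U_m(p)` verbatim — is the file `MizutaniProjectiveMultiplicity.lean`.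

References: [Matsumura1987] §14 (multiplicity; `e(A) = 1` for regular `A`), Thm. 14.3, Thm. 17.10;
[Mizutani1973HironakaGroupSchemes] p. 85 L21–25; [Hironaka1970NumericalCharacters] p. 154 L24–29;
[CossartJannsenSaito2020] §2.2 (Hilbert–Samuel functions).
-/

noncomputable section

open IsLocalRing Finset Literature.RingTheory.HilbertSamuel Literature.AlgebraicGeometry.Resolution
  Summit.ResolutionOfSingularities.ResolutionOfSingularities.Theorems.SigmaMaxModificationsCorridor3.Helpers

namespace Summit.ResolutionOfSingularities.KangarooAtlas.Mizutani

universe u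

/-! ## The Samuel function of a hypersurface singularity and its `d'`-th difference -/

section Combinatorics

/-- One value of the hypersurface Hilbert function in `ℤ`:
`hypersurfaceHFe (d'+1) m i = binom(i+d', d') − [m ≤ i]·binom(i−m+d', d')`. [folklore] -/
theorem hypersurfaceHFe_succ_cast (d' m i : ℕ) :
    (hypersurfaceHFe (d' + 1) m i : ℤ) =
      ((i + d').choose d' : ℤ) - if m ≤ i then ((i - m + d').choose d' : ℤ) else 0 := by
  rw [hypersurfaceHFe_apply]
  have e1 : i + (d' + 1) - 1 = i + d' := by omega
  have e2 : d' + 1 - 1 = d' := by omega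
  rw [e1, e2]
  split_ifs with h
  · have e3 : i - m + (d' + 1) - 1 = i - m + d' := by omega
    rw [e3]
    have hle : (i - m + d').choose d' ≤ (i + d').choose d' := Nat.choose_le_choose d' (by omega)
    push_cast [Nat.cast_sub hle]
    ring
  · simp

/-- The shifted hockey-stick identity `Σ_{i ≤ x} [m ≤ i]·binom(i−m+d', d') = [m ≤ x]·binom(x−m+d'+1, d'+1)`.
[folklore] -/
theorem sum_range_ite_choose (d' m : ℕ) : ∀ x : ℕ,
    (∑ i ∈ range (x + 1), (if m ≤ i then ((i - m + d').choose d' : ℤ) else 0)) =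
      if m ≤ x then ((x - m + d' + 1).choose (d' + 1) : ℤ) else 0 := by
  intro x
  induction x with
  | zero =>
    rw [sum_range_one]
    by_cases h : m ≤ 0
    · have hm : m = 0 := by omega
      subst hm
      simp
    · simp [h]
  | succ x ih =>
    rw [sum_range_succ, ih]
    by_cases h1 : m ≤ x
    · have h2 : m ≤ x + 1 := by omega
      rw [if_pos h1, if_pos h2, if_pos h2]
      have e : x + 1 - m + d' + 1 = (x - m + d' + 1) + 1 := by omega
      have e' : x + 1 - m + d' = x - m + d' + 1 := by omega
      rw [e, e', Nat.choose_succ_succ' (x - m + d' + 1) d']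
      push_cast
      ring
    · rw [if_neg h1, zero_add]
      by_cases h2 : m ≤ x + 1
      · have hm : m = x + 1 := by omega
        subst hm
        rw [if_pos le_rfl, if_pos le_rfl]
        simp
      · rw [if_neg h2, if_neg h2]

/-- **The Samuel function of a hypersurface singularity**: summing `hypersurfaceHFe (d'+1) m` (hockey stick) gives
`χ(x) = Σ_{i ≤ x} H(i) = binom(x+d'+1, d'+1) − [m ≤ x]·binom(x−m+d'+1, d'+1)` (in `ℤ`). [folklore] -/
theorem sum_range_hypersurfaceHFe_cast (d' m x : ℕ) :
    (∑ i ∈ range (x + 1), (hypersurfaceHFe (d' + 1) m i : ℤ)) =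
      ((x + (d' + 1)).choose (d' + 1) : ℤ) -
        if m ≤ x then ((x - m + (d' + 1)).choose (d' + 1) : ℤ) else 0 := by
  simp_rw [hypersurfaceHFe_succ_cast]
  rw [sum_sub_distrib, sum_range_ite_choose]
  have h := Nat.sum_range_add_choose x d'
  have h' : (∑ i ∈ range (x + 1), ((i + d').choose d' : ℤ)) = ((x + d' + 1).choose (d' + 1) : ℤ) := by
    exact_mod_cast h
  rw [h']
  have e1 : x + d' + 1 = x + (d' + 1) := by omega
  have e2 : x - m + d' + 1 = x - m + (d' + 1) := by omega
  rw [e1, e2]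

/-- `Δ^k binom(x + c, k + j) = binom(x + c, j)` (Mathlib `fwdDiff_iter_choose`, shifted by `c`). [folklore] -/
theorem fwdDiff_iter_choose_add (c j k : ℕ) :
    (fwdDiff (1 : ℕ))^[k] (fun x : ℕ => ((x + c).choose (k + j) : ℤ)) = fun x : ℕ => ((x + c).choose j : ℤ) := by
  funext y
  have h := fwdDiff_iter_comp_add (h := 1) (fun x : ℕ => (x.choose (k + j) : ℤ)) c k y
  rw [h, fwdDiff_iter_choose]

/-- `Δ^k (f − g) = Δ^k f − Δ^k g`. [folklore] -/
theorem fwdDiff_iter_sub {G : Type*} [AddCommGroup G] (f g : ℕ → G) (k : ℕ) :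
    (fwdDiff (1 : ℕ))^[k] (f - g) = (fwdDiff (1 : ℕ))^[k] f - (fwdDiff (1 : ℕ))^[k] g := by
  have h := map_sub (fwdDiff_aux.fwdDiffₗ ℕ G 1 ^ k) f g
  simpa only [fwdDiff_aux.coe_fwdDiffₗ_pow] using h

/-- **The `d'`-th difference of the hypersurface Samuel function is the constant `m` from `n = m` on**
(`Δ^{d'} binom(x + d'+1, d'+1) = x + d' + 1`, and the subtracted term is the same function shifted by `m`).
[folklore] -/
theorem fwdDiff_iter_sum_hypersurfaceHFe (d' m n : ℕ) (hn : m ≤ n) :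
    (fwdDiff (1 : ℕ))^[d'] (fun x : ℕ => ∑ i ∈ range (x + 1), (hypersurfaceHFe (d' + 1) m i : ℤ)) n = m := by
  have hfun : (fun x : ℕ => ∑ i ∈ range (x + 1), (hypersurfaceHFe (d' + 1) m i : ℤ)) =
      (fun x : ℕ => ((x + (d' + 1)).choose (d' + 1) : ℤ)) -
        fun x : ℕ => if m ≤ x then ((x - m + (d' + 1)).choose (d' + 1) : ℤ) else 0 := by
    funext x
    rw [sum_range_hypersurfaceHFe_cast]
    rfl
  rw [hfun, fwdDiff_iter_sub, Pi.sub_apply]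
  -- first term
  have h1 : (fwdDiff (1 : ℕ))^[d'] (fun x : ℕ => ((x + (d' + 1)).choose (d' + 1) : ℤ)) n = (n + (d' + 1) : ℕ) := by
    rw [fwdDiff_iter_choose_add (d' + 1) 1 d']
    simp only [Nat.choose_one_right]
  -- second term: the same function shifted by `m`
  have h2 : (fwdDiff (1 : ℕ))^[d']
      (fun x : ℕ => if m ≤ x then ((x - m + (d' + 1)).choose (d' + 1) : ℤ) else 0) n =
      (n - m + (d' + 1) : ℕ) := by
    have hshift := fwdDiff_iter_comp_add (h := 1)
      (fun x : ℕ => if m ≤ x then ((x - m + (d' + 1)).choose (d' + 1) : ℤ) else 0) m d' (n - m)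
    rw [Nat.sub_add_cancel hn] at hshift
    rw [← hshift]
    have hfun2 : (fun r : ℕ => if m ≤ r + m then ((r + m - m + (d' + 1)).choose (d' + 1) : ℤ) else 0) =
        fun r : ℕ => ((r + (d' + 1)).choose (d' + 1) : ℤ) := by
      funext r
      rw [if_pos (Nat.le_add_left m r), Nat.add_sub_cancel]
    rw [hfun2, fwdDiff_iter_choose_add (d' + 1) 1 d']
    simp only [Nat.choose_one_right]
  rw [h1, h2]
  push_cast [Nat.cast_sub hn]
  ring

end Combinatorics

/-! ## `e(A/gA) = ord_A(g)` in a regular local ring -/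

section Hypersurface

variable {A : Type u} [CommRing A] [IsRegularLocalRing A]

/-- A natural number `x : WithBot ℕ∞` with `x + 1 = a + 1` is `a`. [folklore] -/
theorem withBot_eq_of_add_one_eq {x : WithBot ℕ∞} {a : ℕ} (hx : ∃ q : ℕ, x = q)
    (h : x + 1 = ((a + 1 : ℕ) : WithBot ℕ∞)) : x = (a : WithBot ℕ∞) := by
  obtain ⟨q, rfl⟩ := hx
  have hq : q + 1 = a + 1 := by exact_mod_cast h
  have hqa : q = a := by omega
  rw [hqa]

/-- The quotient of a local ring by a proper principal ideal is a local ring (use-site instance for the theorems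
below). [folklore] -/
theorem isLocalRing_quotient_span_singleton {g : A} (hg : g ∈ maximalIdeal A) :
    IsLocalRing (A ⧸ Ideal.span {g}) := by
  have hne : Ideal.span {g} ≠ ⊤ := by
    rw [Ne, Ideal.span_singleton_eq_top]
    exact (IsLocalRing.mem_maximalIdeal g).mp hg
  haveI : Nontrivial (A ⧸ Ideal.span {g}) := (Ideal.Quotient.nontrivial_iff).mpr hne
  exact IsLocalRing.of_surjective' (Ideal.Quotient.mk (Ideal.span {g})) Ideal.Quotient.mk_surjective

/-- **The multiplicity of a hypersurface in a regular local ring is the order of its equation**: for a regular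
local ring `(A, 𝔪)` and `0 ≠ g ∈ 𝔪`, the local ring `A/gA` has Samuel multiplicity `e(A/gA) = ord_𝔪(g)`
(`= max {m : g ∈ 𝔪^m}`; the quotient is a local ring — the instance is taken as a hypothesis, as in the tree's
CJS files, and supplied by `IsLocalRing.of_surjective'` at use sites).  This is the equality behind «the multiplicity of the hypersurface `f = 0` at a point of a
smooth variety is the order of `f` at that point» (Mizutani p. 85 `mult_p(Proj(S/fS))` vs. Hironaka [H4] p. 154
`ν_{x'}(φ/X_0^d)`).  Proof: Hilbert function of `A/(g)` (res-hironaka `hilbertFun_quotient_span_singleton`), its partial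
sums, `dim A/(g) = dim A − 1`, and the `(dim A − 1)`-th difference (module docstring).
[cite: Matsumura1987, §14 (multiplicity e(A); Formula 14.1) and Thm. 14.3; Mizutani1973HironakaGroupSchemes, p. 85 L23–25] -/
theorem samuelMultiplicity_quotient_span_singleton {g : A} (hg : g ∈ maximalIdeal A) (hg0 : g ≠ 0)
    [IsLocalRing (A ⧸ Ideal.span {g})] :
    (samuelMultiplicity (A ⧸ Ideal.span {g}) : ℕ∞) = adicOrder g := by
  classical
  haveI : IsDomain A := isDomain_of_isRegularLocalRing A
  -- the order `m` of `g`: `g ∈ 𝔪^m ∖ 𝔪^{m+1}`, `m ≥ 1`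
  obtain ⟨m, hm⟩ : ∃ m : ℕ, adicOrder g = m := ENat.ne_top_iff_exists.mp (adicOrder_ne_top hg0) |>.imp
    fun m h => h.symm
  have hgm : g ∈ maximalIdeal A ^ m := (le_adicOrder_iff g m).mp (le_of_eq hm.symm)
  have hgm' : g ∉ maximalIdeal A ^ (m + 1) := (adicOrder_lt_iff g m).mp (by
    rw [hm]; exact_mod_cast Nat.lt_succ_self m)
  -- `dim A = d' + 1`, `dim A/(g) = d'`
  have hd : ringKrullDim A = ((maximalIdeal A).spanFinrank : WithBot ℕ∞) :=
    (IsRegularLocalRing.spanFinrank_maximalIdeal (R := A)).symm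
  have hdim := ringKrullDim_quotient_span_singleton_succ_eq_ringKrullDim_of_mem_nonZeroDivisors
    (mem_nonZeroDivisors_of_ne_zero hg0) hg
  obtain ⟨q, hq⟩ := ringKrullDim_eq_nat (A ⧸ Ideal.span {g})
  have hd1 : 1 ≤ (maximalIdeal A).spanFinrank := by
    have h := hdim
    rw [hd, hq] at h
    have h' : q + 1 = (maximalIdeal A).spanFinrank := by exact_mod_cast h
    omega
  obtain ⟨d', hd'⟩ : ∃ d' : ℕ, (maximalIdeal A).spanFinrank = d' + 1 := ⟨_, (Nat.sub_add_cancel hd1).symm⟩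
  have hdQ : ringKrullDim (A ⧸ Ideal.span {g}) = (d' : WithBot ℕ∞) := by
    refine withBot_eq_of_add_one_eq ⟨q, hq⟩ ?_
    rw [hdim, hd, hd']
  -- the Hilbert function of the hypersurface singularity
  have hH : hilbertFun (A ⧸ Ideal.span {g}) = hypersurfaceHFe (d' + 1) m :=
    hilbertFun_quotient_span_singleton hd' hgm hgm'
  -- the multiplicity
  rw [hm]
  have key : samuelMultiplicity (A ⧸ Ideal.span {g}) = m := by
    refine samuelMultiplicity_eq_of_forall_le hdQ (N := m) fun n hn => ?_
    have hfun : (fun x : ℕ => (hilbertSamuelFun (A ⧸ Ideal.span {g}) 1 x : ℤ)) =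
        fun x : ℕ => ∑ i ∈ range (x + 1), (hypersurfaceHFe (d' + 1) m i : ℤ) := by
      funext x
      rw [hilbertSamuelFun, iterPSum_one, psum_apply, hH]
      push_cast
      rfl
    rw [hfun]
    exact fwdDiff_iter_sum_hypersurfaceHFe d' m n hn
  exact_mod_cast key

/-- The same with a prescribed order: if `g ∈ 𝔪^m ∖ 𝔪^{m+1}` (`m ≥ 1`, as `g ∈ 𝔪`... here required through
`hg : g ∈ 𝔪`) then `e(A/gA) = m`. [cite: Matsumura1987, §14 (multiplicity e(A); Formula 14.1)] -/
theorem samuelMultiplicity_quotient_span_singleton_eq {g : A} (hg : g ∈ maximalIdeal A) {m : ℕ}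
    (hgm : g ∈ maximalIdeal A ^ m) (hgm' : g ∉ maximalIdeal A ^ (m + 1)) [IsLocalRing (A ⧸ Ideal.span {g})] :
    samuelMultiplicity (A ⧸ Ideal.span {g}) = m := by
  have hg0 : g ≠ 0 := fun h => hgm' (by rw [h]; exact zero_mem _)
  have h := samuelMultiplicity_quotient_span_singleton hg hg0
  have hord : adicOrder g = m :=
    le_antisymm ((adicOrder_le_iff g m).mpr hgm') ((le_adicOrder_iff g m).mpr hgm)
  rw [hord] at h
  exact_mod_cast h

end Hypersurface

end Summit.ResolutionOfSingularities.KangarooAtlas.Mizutani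

end
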